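import Summits.NavierStokesRegularity.OSWSelfSimilar.SheetRResolventPair
import HarnessLib

/-!
# SHEET-ℝ frame, MODEL ASSEMBLY for Z3-SR-SPEC (P1): the COMPLEX pivot space `L²_w(ℂ) = Lp ℂ 2 μ_w`, its real-pair coordinates,
# and the pivot embedding of the energy space

HONEST FRAMING (cell ns-blowup GROUP B / zone Z3, case Z3-SR-SPEC, PAPER item (P1); 1-D MODEL certificate frame (viscous gCLM/OSW sheet on
the line); not Euler/NS; «violates: none — MODEL»). Nothing here asserts that a profile exists; this file is Hilbert-space plumbing.

The spectral certificate quantifies over the resolvent `R(σ)` of the linearised sheet operator as a `ℂ`-linear bounded operator on an honest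
complex Banach space (`Literature.Analysis.OperatorTheory.IsPseudoResolvent`).  The analytic layers of the tree are REAL (`W L = Lp ℝ 2 μ_w`,
`Esp L hL`); the complex equation with real coefficients is the skew-coupled real pair system of `SheetRResolventPair`.  This file supplies
the dictionary between the two descriptions:

* `Wc L := Lp ℂ 2 (μw L)` — the complex pivot `L²_w(ℂ)`; `reW`, `imW : Wc L →L[ℝ] W L` and `ofRealW : W L →L[ℝ] Wc L` (composition with
  `Complex.reCLM` / `imCLM` / `ofRealCLM`, a.e. formulas `reW_ae` …);
* `toPair : Wc L →L[ℝ] WithLp 2 (W L × W L)`, `ofPair` (inverse to each other: `ofPair_toPair`, `toPair_ofPair`), the ISOMETRY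
  `norm_toPair : ‖toPair G‖ = ‖G‖`, and multiplication by `i` as the rotation `(a, b) ↦ (−b, a)` (`toPair_I_smul`);
* `toComplexCLM` — an `ℝ`-linear bounded map of a complex normed space commuting with `i` IS `ℂ`-linear (the packaging step for `R(σ)`);
* `ιE : Esp L hL →L[ℝ] W L`, the pivot embedding `p ↦ u = prim (der p)` as an `L²_w` class (`= 2·p₀`), `ιE_ae`, `norm_ιE_le : ‖ιE p‖ ≤ 2‖p‖`,
  and its pair version `ιpair`.

Definitions are bundled-map abbreviations of existing Mathlib objects; no new mathematical notion, no named fact.  WHAT THIS IS NOT: not NS;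
no number of record moves.
-/

noncomputable section

namespace Summit.NavierStokesRegularity.OSWSelfSimilar
namespace SheetRComplexPivot

open _root_.MeasureTheory _root_.Set _root_.Filter _root_.Real _root_.Complex SheetRWeightedMeasure SheetREnergySpace SheetRSolutionOperator
open scoped Topology ENNReal ComplexConjugate

/-! ### §1 The complex pivot space and its real-pair coordinates -/

/-- **The complex pivot space** `L²_w(ℂ) := Lp ℂ 2 μ_w`, `μ_w = (L² + ξ²)·Lebesgue`. [folklore] -/
abbrev Wc (L : ℝ) : Type := Lp ℂ 2 (μw L)

variable (L : ℝ)

/-- Real part `L²_w(ℂ) → L²_w(ℝ)` (composition with `Complex.reCLM`). [folklore] -/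
def reW : Wc L →L[ℝ] W L := (Complex.reCLM).compLpL 2 (μw L)

/-- Imaginary part `L²_w(ℂ) → L²_w(ℝ)` (composition with `Complex.imCLM`). [folklore] -/
def imW : Wc L →L[ℝ] W L := (Complex.imCLM).compLpL 2 (μw L)

/-- Real embedding `L²_w(ℝ) → L²_w(ℂ)` (composition with `Complex.ofRealCLM`). [folklore] -/
def ofRealW : W L →L[ℝ] Wc L := (Complex.ofRealCLM).compLpL 2 (μw L)

variable {L}

/-- a.e. formula for `reW`. [folklore] -/
theorem reW_ae (G : Wc L) : ((reW L G : W L) : ℝ → ℝ) =ᵐ[μw L] fun y => ((G : ℝ → ℂ) y).re :=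
  ContinuousLinearMap.coeFn_compLpL _ _

/-- a.e. formula for `imW`. [folklore] -/
theorem imW_ae (G : Wc L) : ((imW L G : W L) : ℝ → ℝ) =ᵐ[μw L] fun y => ((G : ℝ → ℂ) y).im :=
  ContinuousLinearMap.coeFn_compLpL _ _

/-- a.e. formula for `ofRealW`. [folklore] -/
theorem ofRealW_ae (g : W L) : ((ofRealW L g : Wc L) : ℝ → ℂ) =ᵐ[μw L] fun y => (((g : ℝ → ℝ) y : ℝ) : ℂ) :=
  ContinuousLinearMap.coeFn_compLpL _ _

variable (L)

/-- **Real-pair coordinates** `G ↦ (Re G, Im G) ∈ WithLp 2 (L²_w × L²_w)`. [folklore] -/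
def toPair : Wc L →L[ℝ] WithLp 2 (W L × W L) :=
  ((WithLp.prodContinuousLinearEquiv 2 ℝ (W L) (W L)).symm : (W L × W L) →L[ℝ] WithLp 2 (W L × W L)).comp ((reW L).prod (imW L))

/-- **Inverse coordinates** `(a, b) ↦ a + i·b`. [folklore] -/
def ofPair : WithLp 2 (W L × W L) →L[ℝ] Wc L :=
  (ofRealW L).comp (WithLp.fstL 2 ℝ (W L) (W L)) + ((Complex.I : ℂ) • ofRealW L).comp (WithLp.sndL 2 ℝ (W L) (W L))

variable {L}

/-- Components of `toPair`. [folklore] -/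
theorem toPair_fst_snd (G : Wc L) : (toPair L G).fst = reW L G ∧ (toPair L G).snd = imW L G := ⟨rfl, rfl⟩

/-- Formula for `ofPair`. [folklore] -/
theorem ofPair_apply (P : WithLp 2 (W L × W L)) : ofPair L P = ofRealW L P.fst + (Complex.I : ℂ) • ofRealW L P.snd := rfl

/-- a.e. formula for `ofPair`. [folklore] -/
theorem ofPair_ae (P : WithLp 2 (W L × W L)) :
    ((ofPair L P : Wc L) : ℝ → ℂ) =ᵐ[μw L] fun y => (((P.fst : ℝ → ℝ) y : ℝ) : ℂ) + Complex.I * (((P.snd : ℝ → ℝ) y : ℝ) : ℂ) := by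
  rw [ofPair_apply]
  filter_upwards [Lp.coeFn_add (ofRealW L P.fst) ((Complex.I : ℂ) • ofRealW L P.snd), Lp.coeFn_smul (Complex.I : ℂ) (ofRealW L P.snd),
    ofRealW_ae P.fst, ofRealW_ae P.snd] with y h1 h2 h3 h4
  rw [h1, Pi.add_apply, h2, Pi.smul_apply, h3, h4, smul_eq_mul]

/-- `ofPair ∘ toPair = id` (`G = Re G + i Im G`). [folklore] -/
theorem ofPair_toPair (G : Wc L) : ofPair L (toPair L G) = G := by
  apply Lp.ext
  obtain ⟨h1, h2⟩ := toPair_fst_snd G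
  filter_upwards [ofPair_ae (toPair L G), reW_ae G, imW_ae G] with y hy hr hi
  rw [hy, h1, h2, hr, hi, mul_comm]
  exact Complex.re_add_im _

/-- `toPair ∘ ofPair = id`. [folklore] -/
theorem toPair_ofPair (P : WithLp 2 (W L × W L)) : toPair L (ofPair L P) = P := by
  have hfst : (toPair L (ofPair L P)).fst = P.fst := by
    rw [(toPair_fst_snd _).1]
    apply Lp.ext
    filter_upwards [reW_ae (ofPair L P), ofPair_ae P] with y hr ho
    rw [hr, ho]
    simp [Complex.add_re]
  have hsnd : (toPair L (ofPair L P)).snd = P.snd := by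
    rw [(toPair_fst_snd _).2]
    apply Lp.ext
    filter_upwards [imW_ae (ofPair L P), ofPair_ae P] with y hi ho
    rw [hi, ho]
    simp [Complex.add_im]
  exact WithLp.ofLp_injective 2 (Prod.ext hfst hsnd)

/-- **`toPair` is an isometry**: `‖toPair G‖² = ‖Re G‖² + ‖Im G‖² = ‖G‖²`. [folklore] -/
theorem norm_toPair (G : Wc L) : ‖toPair L G‖ = ‖G‖ := by
  have hsqG : ‖G‖ ^ 2 = ∫ y, ‖(G : ℝ → ℂ) y‖ ^ 2 ∂(μw L) := by
    rw [← @inner_self_eq_norm_sq ℂ, L2.inner_def]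
    rw [← integral_re (L2.integrable_inner G G)]
    refine integral_congr_ae (Eventually.of_forall fun y => ?_)
    simp only [inner_self_eq_norm_sq_to_K]
    norm_cast
  have hsq_re : ‖reW L G‖ ^ 2 = ∫ y, ((G : ℝ → ℂ) y).re ^ 2 ∂(μw L) := by
    rw [← real_inner_self_eq_norm_sq, L2.inner_def]
    refine integral_congr_ae ((reW_ae G).mono fun y hy => ?_)
    simp only [hy]
    rw [real_inner_self_eq_norm_sq, Real.norm_eq_abs, sq_abs]
  have hsq_im : ‖imW L G‖ ^ 2 = ∫ y, ((G : ℝ → ℂ) y).im ^ 2 ∂(μw L) := by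
    rw [← real_inner_self_eq_norm_sq, L2.inner_def]
    refine integral_congr_ae ((imW_ae G).mono fun y hy => ?_)
    simp only [hy]
    rw [real_inner_self_eq_norm_sq, Real.norm_eq_abs, sq_abs]
  have hre_int : Integrable (fun y => ((G : ℝ → ℂ) y).re ^ 2) (μw L) := by
    have := (Lp.memLp (reW L G)).integrable_sq
    exact this.congr ((reW_ae G).mono fun y hy => by simp only [hy])
  have him_int : Integrable (fun y => ((G : ℝ → ℂ) y).im ^ 2) (μw L) := by
    have := (Lp.memLp (imW L G)).integrable_sq
    exact this.congr ((imW_ae G).mono fun y hy => by simp only [hy])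
  have hsum : ∫ y, ‖(G : ℝ → ℂ) y‖ ^ 2 ∂(μw L) = (∫ y, ((G : ℝ → ℂ) y).re ^ 2 ∂(μw L)) + ∫ y, ((G : ℝ → ℂ) y).im ^ 2 ∂(μw L) := by
    rw [← integral_add hre_int him_int]
    refine integral_congr_ae (Eventually.of_forall fun y => ?_)
    show ‖(G : ℝ → ℂ) y‖ ^ 2 = ((G : ℝ → ℂ) y).re ^ 2 + ((G : ℝ → ℂ) y).im ^ 2
    rw [Complex.sq_norm, Complex.normSq_apply]
    ring
  obtain ⟨h1, h2⟩ := toPair_fst_snd G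
  have h : ‖toPair L G‖ ^ 2 = ‖G‖ ^ 2 := by
    rw [WithLp.prod_norm_sq_eq_of_L2, h1, h2, hsq_re, hsq_im, hsqG, hsum]
  rw [← Real.sqrt_sq (norm_nonneg (toPair L G)), h, Real.sqrt_sq (norm_nonneg G)]

/-- `‖ofPair P‖ = ‖P‖`. [folklore] -/
theorem norm_ofPair (P : WithLp 2 (W L × W L)) : ‖ofPair L P‖ = ‖P‖ := by
  rw [← norm_toPair (ofPair L P), toPair_ofPair]

/-- **Multiplication by `i` is the rotation** `(a, b) ↦ (−b, a)` in pair coordinates. [folklore] -/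
theorem toPair_I_smul (G : Wc L) :
    (toPair L ((Complex.I : ℂ) • G)).fst = -(toPair L G).snd ∧ (toPair L ((Complex.I : ℂ) • G)).snd = (toPair L G).fst := by
  obtain ⟨h1, h2⟩ := toPair_fst_snd G
  obtain ⟨h1', h2'⟩ := toPair_fst_snd ((Complex.I : ℂ) • G)
  refine ⟨?_, ?_⟩
  · rw [h1', h2]
    apply Lp.ext
    filter_upwards [reW_ae ((Complex.I : ℂ) • G), Lp.coeFn_smul (Complex.I : ℂ) G, Lp.coeFn_neg (imW L G), imW_ae G]
      with y hr hs hn hi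
    rw [hr, hs, hn, Pi.smul_apply, Pi.neg_apply, hi, smul_eq_mul, Complex.I_mul_re]
  · rw [h2', h1]
    apply Lp.ext
    filter_upwards [imW_ae ((Complex.I : ℂ) • G), Lp.coeFn_smul (Complex.I : ℂ) G, reW_ae G] with y hi hs hr
    rw [hi, hs, Pi.smul_apply, hr, smul_eq_mul, Complex.I_mul_im]

/-- `ofPair (−b, a) = i · ofPair (a, b)`. [folklore] -/
theorem ofPair_rot (P : WithLp 2 (W L × W L)) :
    ofPair L (WithLp.toLp 2 (-P.snd, P.fst)) = (Complex.I : ℂ) • ofPair L P := by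
  have h := toPair_I_smul (ofPair L P)
  rw [toPair_ofPair] at h
  have e : toPair L ((Complex.I : ℂ) • ofPair L P) = WithLp.toLp 2 (-P.snd, P.fst) :=
    WithLp.ofLp_injective 2 (Prod.ext h.1 h.2)
  rw [← e, ofPair_toPair]

/-! ### §2 An `ℝ`-linear bounded map commuting with `i` is `ℂ`-linear -/

/-- **Packaging**: an `ℝ`-linear bounded operator on a complex normed space that commutes with multiplication by `i` is a `ℂ`-linear
bounded operator (same underlying function). [folklore] -/
def toComplexCLM {X : Type*} [NormedAddCommGroup X] [NormedSpace ℂ X] [NormedSpace ℝ X] [IsScalarTower ℝ ℂ X]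
    (T : X →L[ℝ] X) (hT : ∀ x, T ((Complex.I : ℂ) • x) = (Complex.I : ℂ) • T x) : X →L[ℂ] X where
  toFun := T
  map_add' := map_add T
  map_smul' := by
    intro c x
    have hdec : ∀ y : X, c • y = c.re • y + c.im • ((Complex.I : ℂ) • y) := fun y => by
      rw [RCLike.real_smul_eq_coe_smul (K := ℂ), RCLike.real_smul_eq_coe_smul (K := ℂ), smul_smul, ← add_smul]
      congr 1
      simpa [mul_comm] using (Complex.re_add_im c).symm
    rw [hdec x, map_add, T.map_smul, T.map_smul, hT, RingHom.id_apply, hdec (T x)]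
  cont := T.continuous

/-- `toComplexCLM T` acts as `T`. [folklore] -/
@[simp] theorem toComplexCLM_apply {X : Type*} [NormedAddCommGroup X] [NormedSpace ℂ X] [NormedSpace ℝ X] [IsScalarTower ℝ ℂ X]
    (T : X →L[ℝ] X) (hT : ∀ x, T ((Complex.I : ℂ) • x) = (Complex.I : ℂ) • T x) (x : X) : toComplexCLM T hT x = T x := rfl

/-! ### §3 The pivot embedding of the energy space: `p ↦ u = prim (der p) = 2p₀` as an `L²_w` class -/

/-- **Pivot embedding** `ιE : Esp L hL →L[ℝ] W L`, `p ↦ 2·p₀` (`= prim (der p)` a.e.). [folklore] -/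
def ιE (hL : 0 < L) : Esp L hL →L[ℝ] W L :=
  (2 : ℝ) • ((WithLp.fstL 2 ℝ (W L) (W L)).comp (Esp L hL).subtypeL)

/-- `ιE p = 2·p₀`. [folklore] -/
theorem ιE_apply (hL : 0 < L) (p : Esp L hL) : ιE hL p = (2 : ℝ) • ((p : WithLp 2 (W L × W L)).fst : W L) := rfl

/-- `ιE p = prim (der p)` Lebesgue-a.e. [folklore] -/
theorem ιE_ae (hL : 0 < L) (p : Esp L hL) : ((ιE hL p : W L) : ℝ → ℝ) =ᵐ[volume] prim (der p) := by
  rw [ιE_apply]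
  filter_upwards [ae_volume_of_ae_μw hL (Lp.coeFn_smul (2 : ℝ) ((p : WithLp 2 (W L × W L)).fst : W L)), prim_snd_ae_eq hL p]
    with y h1 h2
  rw [h1, Pi.smul_apply, smul_eq_mul, der_def, h2]

/-- `‖ιE p‖ = 2‖p₀‖ = √∫w·prim(der p)² ≤ 2‖p‖`. [folklore] -/
theorem norm_ιE_le (hL : 0 < L) (p : Esp L hL) :
    ‖ιE hL p‖ = Real.sqrt (∫ y, (L ^ 2 + y ^ 2) * prim (der p) y ^ 2) ∧ ‖ιE hL p‖ ≤ 2 * ‖p‖ := by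
  have hn : ‖ιE hL p‖ = 2 * ‖((p : WithLp 2 (W L × W L)).fst : W L)‖ := by
    rw [ιE_apply, norm_smul, Real.norm_eq_abs, abs_two]
  obtain ⟨-, -, -, -, e0, -⟩ := profile_facts hL p
  refine ⟨by rw [hn, e0], ?_⟩
  rw [hn]
  exact mul_le_mul_of_nonneg_left (WithLp.norm_fst_le (x := (p : WithLp 2 (W L × W L)))) zero_le_two

/-- **Pair pivot embedding** `(p_R, p_I) ↦ (ιE p_R, ιE p_I)`. [folklore] -/
def ιpair (hL : 0 < L) : WithLp 2 (Esp L hL × Esp L hL) →L[ℝ] WithLp 2 (W L × W L) :=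
  ((WithLp.prodContinuousLinearEquiv 2 ℝ (W L) (W L)).symm : (W L × W L) →L[ℝ] WithLp 2 (W L × W L)).comp
    (((ιE hL).comp (WithLp.fstL 2 ℝ (Esp L hL) (Esp L hL))).prod ((ιE hL).comp (WithLp.sndL 2 ℝ (Esp L hL) (Esp L hL))))

/-- Components of `ιpair`. [folklore] -/
theorem ιpair_fst_snd (hL : 0 < L) (P : WithLp 2 (Esp L hL × Esp L hL)) :
    (ιpair hL P).fst = ιE hL P.fst ∧ (ιpair hL P).snd = ιE hL P.snd := ⟨rfl, rfl⟩

/-- `‖ιpair P‖ ≤ 2‖P‖`. [folklore] -/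
theorem norm_ιpair_le (hL : 0 < L) (P : WithLp 2 (Esp L hL × Esp L hL)) : ‖ιpair hL P‖ ≤ 2 * ‖P‖ := by
  obtain ⟨h1, h2⟩ := ιpair_fst_snd hL P
  have hsq : ‖ιpair hL P‖ ^ 2 ≤ (2 * ‖P‖) ^ 2 := by
    rw [WithLp.prod_norm_sq_eq_of_L2, h1, h2, mul_pow, WithLp.prod_norm_sq_eq_of_L2]
    nlinarith [(norm_ιE_le hL P.fst).2, (norm_ιE_le hL P.snd).2, norm_nonneg (ιE hL P.fst), norm_nonneg (ιE hL P.snd)]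
  nlinarith [hsq, norm_nonneg (ιpair hL P), norm_nonneg P]

end SheetRComplexPivot
end Summit.NavierStokesRegularity.OSWSelfSimilar

end
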